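/- Copyright: the b2b-balaban cell (near-miss cell 7), T⁴-continuum fan-out; row NE7b CRUX team (2), seat
t4-ne7b-formalise-leaf-05 (gen 33) — IR-46-2's standing division «… leaf-05 toy-instantiates» applied to the custodian
leaf-03 g27's D-50-1 «THE DECORATED RECORD» (`HistoryRealiseCellsRunAssemblyWTVSDataLWD` ∕ `…AssemblyWTVSLWD`, OWNER g50
W-ne7bp1-g50-1 (d2) ∕ W-ne7bp1-g50-3), part 9 of the sanity series.  Released under the licence of the surrounding project. -/
import Summits.QuantumFields.BalabanUV.T4Continuum.Support.HistoryRealiseCellsRunAssemblyWTVSSanityLWEnd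
import Summits.QuantumFields.BalabanUV.T4Continuum.Support.HistoryRealiseCellsRunAssemblyWTVSSanityLWDecor
import Summits.QuantumFields.BalabanUV.T4Continuum.Support.HistoryRealiseCellsRunAssemblyWTVSLWD

/-!
# Sanity for the (α) assembly, part 9: THE DECORATED RECORD `HistReadDataLWD` — THE CONVERSE JUNCTION `toLWD` (an LW
record plus a fibre decoration ON ITS OWN LETTERS is an LWD record) AND ITS KERNEL INHABITANT ON THE CELL's TOY DATUM, NO
DATUM HYPOTHESIS; FILE 2's `toLW` ∕ §2 RUN BY NAME (companion of `HistoryRealiseCellsRunAssemblyWTVSDataLWD` ∕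
`…AssemblyWTVSLWD`; lineage `t4-ne7b-formalise-leaf-05` gen 33)

Summits-side support leaf of the T⁴-continuum cell (rung (B)+1 on a FINITE torus only; NOT infinite volume, NOT the
mass gap, NOT Clay; NOT a proof of NE7b — NOT PRINTED, NOT PROVED).  [decided toy] over parts 7∕8 and the custodian's D-50-1
pair, REUSED BY NAME; ONE generic `def` (`HistReadDataLW.toLWD`: 119 copies + `decor := X` — the converse of the
custodian's `HistReadDataLWD.toLW`, which REPLACES `decor` by `hρ := hρ_of_indexDecor …`); nothing printed asserted, no
`def … : Prop` fact, no cite-tagged hypothesis, zero `sorry`.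

§10 **`HistReadDataLW.toLWD (Dd) (X : IndexDecor Dd.ℛ Dd.Φf Dd.l₀ Dd.K₀ Dd.W Dd.φB Dd.φR (cellA n F.L Dd.ℛ) (physA …) jhalf Dc Sl)
: HistReadDataLWD … Dc Sl …`** — the road leaf-02's key-side instance (IR-50-2) and every toy take: decorate an LW record on
its own reading ∕ letters; `toLWD_decor`, `toLW_toLWD_hρ` (round trip: the LW record recovered from `toLWD` carries
`hρ := hρ_of_indexDecor _ _ X`, by `rfl`).
§11 **`histReadDataLWD_toyData`** ∕ **`nonempty_histReadDataLWD_toyData`**: `HistReadDataLWD (toyData F G) C₃ O₁ θᵥ 1 1 n hn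
(gW F.L S) [] cΛ Lr Φ β₀ 4 2 1 1 1 3 Unit Unit Isk Isk …` — ALL 120 FIELDS, NO DATUM HYPOTHESIS (part 7's inhabitant decorated
by part 8's `indexDecor_toy₄`: EMPTY decoration data, (ρ0) by construction); FILE 2's `toLW` and §2 on it beyond the two
windows, and UNCONDITIONALLY **`exists_countRoadWitnessT3bWTVSL_toyData_viaLWD`**.

HONEST.  «inhabitable» = «no field unsatisfiable as typed, jointly» at toy letters (c2) with `liveCV = ∅` — the decoration
is EMPTY, every key-indexed display VACUOUS; nothing about Bałaban's index reading (ρ1), envelopes (ρ2) or share check (ρ3);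
(B) FAILS on `toyData` (FILE 2 §3 has no instance there); BY-NAME EFFECT ON THE WALL: NONE; NE7b NOT proved; spine 0∕9.
HONEST DEPENDENCY (cell): continuum YM on T⁴ ⇐ BetaPertH ∧ nine spine estimates (0/9 proved); BetaPertH ⇐ (D1) ∧ (D4) ∧
CAP+tail; G-an2-4 gates asym, D1 and NE2/3/4.  Unchanged here.
-/

open Finset MeasureTheory
open Literature.MathematicalPhysics.QuantumFieldTheory.Balaban1983to89
open T4PersistenceDictionary T4PersistentHistoryCount T4BankedInduction T4PrintedShapeBanking
open T4WeightBudget T4GlobalDenominator T4LiveClassFibration T4LiveStructureGas T4LiveGasToTerms T4RecordPriceSeam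
open T4PartnerMultiplicity T4IndicatorShell T4MatchingAssembly T4MatchingClosure T4MatchingClosureSocket T4Continuum
open T4StabilitySocket T4BranchingRecordsGas T4TaggedShapeBanking T4CanonicalMenus T4RenewalChains
open Summit.QuantumFields.BalabanUV.T4Continuum.HistoryFlow Summit.QuantumFields.BalabanUV.T4Continuum.HistoryGen
open Summit.QuantumFields.BalabanUV.T4Continuum.HistoryGenealogyRealise
open Summit.QuantumFields.BalabanUV.T4Continuum.HistoryGenealogyInstantiate
open Summit.QuantumFields.BalabanUV.T4Continuum.HistoryAssemblyTerms
open Summit.QuantumFields.BalabanUV.T4Continuum.HistoryAssemblyMult Summit.QuantumFields.BalabanUV.T4Continuum.HistoryAssemblyMultKey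
open Summit.QuantumFields.BalabanUV.T4Continuum.HistorySocketTH
open Summit.QuantumFields.BalabanUV.T4Continuum.HistoryRealiseCellsRunApexT3bWTVS
open Summit.QuantumFields.BalabanUV.T4Continuum.HistoryRealiseCellsRunApexT3bWTVSL
open Summit.QuantumFields.BalabanUV.T4Continuum.B16HistoryIndexedRepr
open Summit.QuantumFields.BalabanUV.T4Continuum.B16HistoryIndexedTrunc
open Summit.QuantumFields.BalabanUV.T4Continuum.HistoryConstants Summit.QuantumFields.BalabanUV.T4Continuum.HistoryBankingDiscountCharge
open Summit.QuantumFields.BalabanUV.T4Continuum.HistoryBankingCreditRead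
open Summit.QuantumFields.BalabanUV.T4Continuum.HistoryBankingFibreRoom
open Summit.QuantumFields.BalabanUV.T4Continuum.HistoryPriceNodeSum Summit.QuantumFields.BalabanUV.T4Continuum.HistoryPriceKeys
open Summit.QuantumFields.BalabanUV.T4Continuum.HistoryRealiseCellsRunSupplyWTVS
open Summit.QuantumFields.BalabanUV.T4Continuum.HistoryRealiseCellsRunSupplyKeysWTVS
open Summit.QuantumFields.BalabanUV.T4Continuum.HistoryRealiseCellsRunSupplyWTVSSanity
open Summit.QuantumFields.BalabanUV.T4Continuum.HistoryRealiseCellsRunAssemblyWTVSData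
open Summit.QuantumFields.BalabanUV.T4Continuum.HistoryRealiseCellsRunAssemblyWTVSDataL
open Summit.QuantumFields.BalabanUV.T4Continuum.HistoryRealiseCellsRunAssemblyWTVSDataLW
open Summit.QuantumFields.BalabanUV.T4Continuum.HistoryRealiseCellsRunAssemblyWTVSDataLWD
open Summit.QuantumFields.BalabanUV.T4Continuum.HistoryRealiseCellsRunAssemblyWTVSLW
open Summit.QuantumFields.BalabanUV.T4Continuum.HistoryRealiseCellsRunAssemblyWTVSLWD
open Summit.QuantumFields.BalabanUV.T4Continuum.HistoryRealiseCellsRunSupplyFibreWTVS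
open Summit.QuantumFields.BalabanUV.T4Continuum.HistoryRealiseCellsRunApexWitness
open Summit.QuantumFields.BalabanUV.T4Continuum.HistoryBankingSharpShares (ell sBsharp)
open Summit.QuantumFields.BalabanUV.T4Continuum.HistoryBankingRoundingUnrounded (sRunr ApFlat)
open Summit.QuantumFields.BalabanUV.T4Continuum.HistoryBankingRoundingSupply (ellStar)
open Summit.QuantumFields.BalabanUV.T4Continuum.HistoryBankingVolumeWindow (uvol lamVol jvol)
open Summit.QuantumFields.BalabanUV.T4Continuum.HistoryBankingVolumeSupply (ellVol)
open Missing AveragingRT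

namespace Summit.QuantumFields.BalabanUV.T4Continuum.HistoryRealiseCellsRunAssemblyWTVSSanity

noncomputable section

open B16HistoryIndexedRepr.Sanity B16HistoryIndexedRepr.SanityInput HistoryConstants.Sanity

set_option synthInstance.maxSize 1024

/-! ## §10 The converse junction: an LW record plus a decoration on its own letters is an LWD record -/

section Junction

variable {F : T4Family} {G : Type*} [GaugeGroup G] [MeasurableSpace G] [HaarData G] [RegularGaugeGroup G]
  {D : FiniteEpsData F G} {C : T4PrintedShapeBanking.Consts} {O : PrintedO1s} {θv : ℝ} {rr d n : ℕ} {hn : 0 < n}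
  {g₀ : ℕ → ℝ} {os : List (ULoop F)} {cΛ Lr Φ β₀ : ℝ} {p₁ η η' κ κ₂ κᵥ : ℕ} {DomK : ℕ → Type}
  {I : (K : ℕ) → HIndex (DomK K)} [DecidableEq (HIndex.Idx I)] {DomK' : ℕ → Type} {I' : (K : ℕ) → HIndex (DomK' K)}
  {Xs : ℕ → Type} [∀ K, MeasurableSpace (Xs K)] {μ : (K : ℕ) → Measure (Xs K)} [∀ K, IsFiniteMeasure (μ K)]
  {𝒢 : (K : ℕ) → GoodClass (Xs K)} {Y : ℕ → Type} [∀ K, MeasurableSpace (Y K)] {νB : (K : ℕ) → Measure (Y K)}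
  [∀ K, IsFiniteMeasure (νB K)] {𝒢' : (K : ℕ) → GoodClass (Y K)}

omit [RegularGaugeGroup G] in
/-- **THE CONVERSE JUNCTION** (of the custodian's `HistReadDataLWD.toLW`): a prefix-twin record `HistReadDataLW` together with
a fibre decoration `IndexDecor` ON ITS OWN reading, letters, radius, threshold, envelope and shares IS a decorated record
`HistReadDataLWD` — 119 fields copied, `decor := X`. [folklore] -/
def _root_.Summit.QuantumFields.BalabanUV.T4Continuum.HistoryRealiseCellsRunAssemblyWTVSDataLW.HistReadDataLW.toLWD
    (Dd : HistReadDataLW D C O θv rr d n hn g₀ os cΛ Lr Φ β₀ p₁ η η' κ κ₂ κᵥ I I' Xs μ 𝒢 Y νB 𝒢') {Dc Sl : Type}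
    (X : IndexDecor Dd.ℛ Dd.Φf Dd.l₀ Dd.K₀ Dd.W Dd.φB Dd.φR (cellA n F.L Dd.ℛ)
      (physA n F.L hn (lt_of_lt_of_le (by norm_num) (two_le_L F)) Dd.ℛ) jhalf Dc Sl) :
    HistReadDataLWD D C O θv rr d n hn g₀ os cΛ Lr Φ β₀ p₁ η η' κ κ₂ κᵥ Dc Sl I I' Xs μ 𝒢 Y νB 𝒢' where
  l₀ := Dd.l₀
  vol := Dd.vol
  l₀_pos := Dd.l₀_pos
  vol_pos := Dd.vol_pos
  K₀ := Dd.K₀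
  RA := Dd.RA
  ρA := Dd.ρA
  holdsA := Dd.holdsA
  intA := Dd.intA
  H2A := Dd.H2A
  ℛ := Dd.ℛ
  hL := Dd.hL
  hs := Dd.hs
  Φf := Dd.Φf
  hR := Dd.hR
  isRj := Dd.isRj
  one_le_R := Dd.one_le_R
  hL4 := Dd.hL4
  hprof := Dd.hprof
  hdrop := Dd.hdrop
  hN := Dd.hN
  hRm := Dd.hRm
  hRmS := Dd.hRmS
  hRm2 := Dd.hRm2
  hD := Dd.hD
  hreg := Dd.hreg
  hn₁ := Dd.hn₁
  hE₂ := Dd.hE₂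
  hE₃pos := Dd.hE₃pos
  sB := Dd.sB
  φB := Dd.φB
  φR := Dd.φR
  β' := Dd.β'
  hF := Dd.hF
  h29 := Dd.h29
  W := Dd.W
  one_le_W := Dd.one_le_W
  Wi := Dd.Wi
  BAi := Dd.BAi
  mi := Dd.mi
  hWi := Dd.hWi
  hBA := Dd.hBA
  hmi := Dd.hmi
  decor := X
  c₀ := Dd.c₀
  n₁ := Dd.n₁
  c₀_pos := Dd.c₀_pos
  floor := Dd.floor
  floor' := Dd.floor'
  sites := Dd.sites
  sites' := Dd.sites'
  RB := Dd.RB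
  ρB := Dd.ρB
  holdsB := Dd.holdsB
  intB := Dd.intB
  H2B := Dd.H2B
  trunc := Dd.trunc
  htr := Dd.htr
  dB := Dd.dB
  mup := Dd.mup
  sB' := Dd.sB'
  φB' := Dd.φB'
  φR' := Dd.φR'
  upB := Dd.upB
  deadB_nonneg := Dd.deadB_nonneg
  resumB := Dd.resumB
  mup_bd := Dd.mup_bd
  shA := Dd.shA
  shB := Dd.shB
  Wsh := Dd.Wsh
  shell := Dd.shell
  Cc := Dd.Cc
  Rr := Dd.Rr
  CcRec := Dd.CcRec
  RrRec := Dd.RrRec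
  ν := Dd.ν
  u := Dd.u
  s₂ := Dd.s₂
  q₀ := Dd.q₀
  r := Dd.r
  s := Dd.s
  budget := Dd.budget
  sum_r := Dd.sum_r
  sum_u := Dd.sum_u
  sum_s := Dd.sum_s
  sum_s₂ := Dd.sum_s₂
  hcΛ := Dd.hcΛ
  hΛ := Dd.hΛ
  hθv := Dd.hθv
  hβ₀ := Dd.hβ₀
  hLr := Dd.hLr
  hΦ := Dd.hΦ
  m := Dd.m
  hm := Dd.hm
  hexpR := Dd.hexpR
  hexpR' := Dd.hexpR'
  hexpB := Dd.hexpB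
  hexpF := Dd.hexpF
  hexpV := Dd.hexpV
  hη := Dd.hη
  hη' := Dd.hη'
  hκ := Dd.hκ
  hκ₂ := Dd.hκ₂
  hκᵥ := Dd.hκᵥ
  hp₀ := Dd.hp₀
  hAp := Dd.hAp
  hγ₀ := Dd.hγ₀
  hA₁ := Dd.hA₁
  hA₀ := Dd.hA₀
  hM := Dd.hM
  hβd := Dd.hβd
  hφB := Dd.hφB
  hφR := Dd.hφR
  hφB' := Dd.hφB'
  hφR' := Dd.hφR'
  hsB := Dd.hsB
  hsB' := Dd.hsB'
  p27 := Dd.p27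
  hp27 := Dd.hp27
  h27 := Dd.h27

omit [RegularGaugeGroup G] in
/-- the decoration of the junction is the given one [folklore] -/
theorem toLWD_decor (Dd : HistReadDataLW D C O θv rr d n hn g₀ os cΛ Lr Φ β₀ p₁ η η' κ κ₂ κᵥ I I' Xs μ 𝒢 Y νB 𝒢')
    {Dc Sl : Type} (X : IndexDecor Dd.ℛ Dd.Φf Dd.l₀ Dd.K₀ Dd.W Dd.φB Dd.φR (cellA n F.L Dd.ℛ)
      (physA n F.L hn (lt_of_lt_of_le (by norm_num) (two_le_L F)) Dd.ℛ) jhalf Dc Sl) :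
    (Dd.toLWD X).decor = X := rfl

omit [RegularGaugeGroup G] in
/-- **ROUND TRIP**: the custodian's `toLW` of the junction is the LW record with `hρ` READ OFF THE DECORATION
(`hρ_of_indexDecor`) — reading, letters, operations unchanged (`rfl`). [folklore] -/
theorem toLW_toLWD_data (Dd : HistReadDataLW D C O θv rr d n hn g₀ os cΛ Lr Φ β₀ p₁ η η' κ κ₂ κᵥ I I' Xs μ 𝒢 Y νB 𝒢')
    {Dc Sl : Type} (X : IndexDecor Dd.ℛ Dd.Φf Dd.l₀ Dd.K₀ Dd.W Dd.φB Dd.φR (cellA n F.L Dd.ℛ)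
      (physA n F.L hn (lt_of_lt_of_le (by norm_num) (two_le_L F)) Dd.ℛ) jhalf Dc Sl) :
    (Dd.toLWD X).toLW.ℛ = Dd.ℛ ∧ (Dd.toLWD X).toLW.Φf = Dd.Φf ∧ (Dd.toLWD X).toLW.RA = Dd.RA ∧
      (Dd.toLWD X).toLW.RB = Dd.RB ∧ (Dd.toLWD X).toLW.K₀ = Dd.K₀ ∧ (Dd.toLWD X).toLW.l₀ = Dd.l₀ :=
  ⟨rfl, rfl, rfl, rfl, rfl, rfl⟩

end Junction

/-! ## §11 The decorated record on the toy datum — no datum hypothesis — and FILE 2 on it -/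

section ToyData

variable (F : T4Family) (G : Type) [GaugeGroup G] [MeasurableSpace G] [HaarData G] [RegularGaugeGroup G]

/-- **THE NAMED INHABITANT OF THE DECORATED RECORD**: part 7's `histReadDataLW_toyData` decorated by part 8's
`indexDecor_toy₄` (EMPTY decoration ∕ slice data, `Dc := Sl := Unit`), every `1 ≤ S`, `0 < θᵥ`, `0 ≤ cΛ Lr Φ β₀`. [decided toy] -/
def histReadDataLWD_toyData {S : ℕ} (hS : 1 ≤ S) {θv : ℝ} (hθv : 0 < θv) {cΛ Lr Φ : ℝ} (hcΛ : 0 ≤ cΛ) (hLr : 0 ≤ Lr)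
    (hΦ : 0 ≤ Φ) {β₀ : ℝ} (hβ₀ : 0 ≤ β₀) (n : ℕ) (hn : 0 < n) :
    HistReadDataLWD (toyData F G) C₃ O₁ θv 1 1 n hn (gW F.L S) ([] : List (ULoop F)) cΛ Lr Φ β₀ 4 2 1 1 1 3 Unit Unit
      Isk Isk (fun _ => Unit) μ₀ (fun _ => GoodClass.top Unit) (fun _ => Unit) μ₀ (fun _ => GoodClass.top Unit) :=
  (histReadDataLW_toyData F G hS hθv hcΛ hLr hΦ hβ₀ n hn).toLWD
    (indexDecor_toy₄ F.L (F.L ^ S) n hn (two_le_L F) O₁ (O₁.A₁ ^ 2) C₃ Lr 4 cΛ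
      (fun K => ((toyData F G).C ⟨K, F.m, gW F.L S K⟩).flow.g) (ZD (toyData F G) (gW F.L S) [])
      (fun K t => one_le_lamVol_toyData F G hcΛ S K t) 1 0 (fun _ => 2) (fun _ _ _ => 0) fun _ _ => 0)

/-- **`HistReadDataLWD` IS INHABITED — ALL 120 FIELDS, NO DATUM HYPOTHESIS** — on the toy datum. [decided toy] -/
theorem nonempty_histReadDataLWD_toyData {S : ℕ} (hS : 1 ≤ S) {θv : ℝ} (hθv : 0 < θv) {cΛ Lr Φ : ℝ} (hcΛ : 0 ≤ cΛ)
    (hLr : 0 ≤ Lr) (hΦ : 0 ≤ Φ) {β₀ : ℝ} (hβ₀ : 0 ≤ β₀) (n : ℕ) (hn : 0 < n) :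
    Nonempty (HistReadDataLWD (toyData F G) C₃ O₁ θv 1 1 n hn (gW F.L S) ([] : List (ULoop F)) cΛ Lr Φ β₀ 4 2 1 1 1 3
      Unit Unit Isk Isk (fun _ => Unit) μ₀ (fun _ => GoodClass.top Unit) (fun _ => Unit) μ₀ (fun _ => GoodClass.top Unit)) :=
  ⟨histReadDataLWD_toyData F G hS hθv hcΛ hLr hΦ hβ₀ n hn⟩

/-- **FILE 2 §2 (LWD) RUN BY NAME ON IT** beyond the two windows: the GUARDED witness through `toLW` ∘ the prefix road. [decided toy] -/
theorem nonempty_countRoadWitnessT3bWTVSL_toyData_viaLWD {S : ℕ} (hS : 1 ≤ S) {θv : ℝ} (hθv : 0 < θv) {cΛ Lr Φ : ℝ}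
    (hcΛ : 0 ≤ cΛ) (hLr : 0 ≤ Lr) (hΦ : 0 ≤ Φ) {β₀ : ℝ} (hβ₀ : 0 ≤ β₀) (n : ℕ) (hn : 0 < n)
    (hr : ellStar C₃ O₁ F.L (O₁.d + 3) 2 1 1 (ApFlat O₁.γ₀ O₁.A₁ O₁.M Lr O₁.d) Φ ≤ (F.L : ℝ) ^ S)
    (hv : ellVol C₃ 1 1 3 cΛ θv (1 + β₀) (jvol 1 (1 + β₀)) ≤ (F.L : ℝ) ^ S) :
    Nonempty (CountRoadWitnessT3bWTVSL (toyData F G) C₃ O₁ θv 1 1 n hn (gW F.L S) ([] : List (ULoop F)) (HIndex.Idx Isk)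
      (ℕ × Lab 1) (Lab 1)) :=
  nonempty_countRoadWitnessT3bWTVSL_of_histReadingLWD (histReadDataLWD_toyData F G hS hθv hcΛ hLr hΦ hβ₀ n hn)
    (inInterval_toyData_gW F G hr) (inInterval_toyData_gW F G hv)

/-- **… UNCONDITIONALLY for SOME window run** (`exists_pow_windows`). [decided toy] -/
theorem exists_countRoadWitnessT3bWTVSL_toyData_viaLWD {θv : ℝ} (hθv : 0 < θv) {cΛ Lr Φ : ℝ} (hcΛ : 0 ≤ cΛ)
    (hLr : 0 ≤ Lr) (hΦ : 0 ≤ Φ) {β₀ : ℝ} (hβ₀ : 0 ≤ β₀) (n : ℕ) (hn : 0 < n) :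
    ∃ S : ℕ, Nonempty (CountRoadWitnessT3bWTVSL (toyData F G) C₃ O₁ θv 1 1 n hn (gW F.L S) ([] : List (ULoop F))
      (HIndex.Idx Isk) (ℕ × Lab 1) (Lab 1)) := by
  obtain ⟨S, hS, hr, hv⟩ := exists_pow_windows F
    (ellStar C₃ O₁ F.L (O₁.d + 3) 2 1 1 (ApFlat O₁.γ₀ O₁.A₁ O₁.M Lr O₁.d) Φ) (ellVol C₃ 1 1 3 cΛ θv (1 + β₀) (jvol 1 (1 + β₀)))
  exact ⟨S, nonempty_countRoadWitnessT3bWTVSL_toyData_viaLWD F G hS hθv hcΛ hLr hΦ hβ₀ n hn hr hv⟩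

end ToyData

end

end Summit.QuantumFields.BalabanUV.T4Continuum.HistoryRealiseCellsRunAssemblyWTVSSanity
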